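import Summits.QuantumFields.YangMills.Theorems.AlphaInputsT3ACv3CovLinAvgFrame
import HarnessLib

/-!
# `AlphaInputsT3ACv3RelativeGauge` — STRATEGY B for 2′, the (FL) row under OWNER RULING g24-№4: **FRAMES ON STENCILS — TWO GAUGES THAT FLATTEN THE SAME FIELD DIFFER BY A NEAR-CONSTANT
# ROTATION** (the κ-side input «R5» of ★w1 LEAD's memo v2.1, in gauge-agnostic algebraic form) — lane `pub-balaban3d` ∕ cell `ym3-torus`, seat `ym-ust-19936-w4` (g0)

WHY (cell `ym3-torus` STATUS 2026-08-28; memo `NEWTON-FL-FRAMES-w4-g0.md` §2, 19936 evidence #58).  In the Newton assembly for `hLift` the linear maps `T` (rotated flat `avgCLM`, per coarse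
bond, in the stencil gauge `g_c`) and `R` (rotated `liftSCLM`, per block, in the stencil gauge `g_β`) are written in DIFFERENT local gauges of the same start `U₀`; `T∘R = 1 + O(κ)` with κ
controlled by the NON-CONSTANCY of the relative gauge `t = g_c·g_β⁻¹` on the overlap (a constant relative rotation costs nothing: `liftS` and `linAvg` commute with constant `Ad`).  THIS
FILE proves the drift bound WITHOUT any Stokes∕comb geometry: if both gauged fields `U^{g₁}`, `U^{g₂}` are η₁-, η₂-flat on the bonds of a walk from `x₀` to `x`, then
`‖t(x) − t(x₀)‖ ≤ (η₁ + η₂)·|walk|`, because ONE bond `b = (x → x′)` transports the relative gauge by `t(x′) = (U^{g₁}_b)⁻¹·t(x)·U^{g₂}_b` (§1).  With stencil axial gauges of a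
dilute field (η = O(L^k·ε·L^{−2k})) and overlaps of diameter O(L^k) this is κ = O(ε), ABSOLUTE — memo §2.
* §1 `relGauge_tgt_eq` (the one-bond transport identity, in `SU(n)`), `norm_relGauge_tgt_sub_src_le` (`‖t(b₊) − t(b₋)‖ ≤ ‖U^{g₁}_b − 1‖ + ‖U^{g₂}_b − 1‖`).
* §2 ★★ `norm_relGauge_walkEnd_sub_le` (drift along any lattice walk: `≤ (η₁+η₂)·|w|`).
* §3 consequences for rotated data: `norm_conj_sub_conj_le` (`‖t X t* − t₀ X t₀*‖ ≤ 2‖t − t₀‖·‖X‖`), ★ `norm_conj_relGauge_walkEnd_sub_le`.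
Count-neutral helper toward R3 2′ (items 19936∕19935); `hLift`∕(FL) NOT proved here; registry untouched; nothing about d = 4, the continuum, or a mass gap; YM₃ on T³ is rung R3, not Clay.

References: T. Bałaban, Commun. Math. Phys. 98 (1985) 17–51 [Balaban1985Averaging] ((8), (11)–(13) pp.18–19, (19) p.21); CMP 102 (1985) 277–309 [Balaban1985Variational] ((4) p.278:
gauge transformations restricted along the block centres).
-/

set_option autoImplicit false

noncomputable section

open scoped Matrix.Norms.L2Operator

namespace Summit.QuantumFields.YangMills.Theorems.RelativeGauge

open Literature.MathematicalPhysics.QuantumFieldTheory.Balaban1983to89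
open T4Continuum
open Summit.QuantumFields.YangMills.Theorems.CovLinAvgFrame (coe_gaugeAct)
open Summit.QuantumFields.YangMills.Theorems.Prop7HolRatioPerStep (coe_star_mul_self coe_mul_star_self)

variable {n : Type*} [Fintype n] [DecidableEq n] [Nonempty n] {P : Params} {j : ℕ}

/-! ## §1 One bond transports the relative gauge -/

/-- **THE ONE-BOND TRANSPORT OF THE RELATIVE GAUGE** (group identity): with `t(x) = g₁(x)·g₂(x)⁻¹` and `U^{g} _b = g(b₋)U_b g(b₊)⁻¹`,
`t(b₊) = (U^{g₁}_b)⁻¹ · t(b₋) · U^{g₂}_b`. [cite: Balaban1985Averaging, (8) p.18] -/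
theorem relGauge_tgt_eq (g₁ g₂ : GaugeTransf P j (Matrix.specialUnitaryGroup n ℂ)) (U : GaugeField P j (Matrix.specialUnitaryGroup n ℂ)) (b : PBond P j) :
    g₁ b.tgt * (g₂ b.tgt)⁻¹ = (GaugeField.gaugeAct g₁ U b)⁻¹ * (g₁ b.src * (g₂ b.src)⁻¹) * GaugeField.gaugeAct g₂ U b := by
  show g₁ b.tgt * (g₂ b.tgt)⁻¹ = (g₁ b.src * U b * (g₁ b.tgt)⁻¹)⁻¹ * (g₁ b.src * (g₂ b.src)⁻¹) * (g₂ b.src * U b * (g₂ b.tgt)⁻¹)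
  group

/-- **ONE BOND MOVES THE RELATIVE GAUGE BY AT MOST THE TWO FLATNESS DEFECTS**: `‖t(b₊) − t(b₋)‖ ≤ ‖U^{g₁}_b − 1‖ + ‖U^{g₂}_b − 1‖` (operator norm; `A⁻¹ t B − t = (A⁻¹ − 1)tB + t(B − 1)`).
[cite: Balaban1985Averaging, (19) p.21] -/
theorem norm_relGauge_tgt_sub_src_le (g₁ g₂ : GaugeTransf P j (Matrix.specialUnitaryGroup n ℂ)) (U : GaugeField P j (Matrix.specialUnitaryGroup n ℂ)) (b : PBond P j) :
    ‖((g₁ b.tgt * (g₂ b.tgt)⁻¹ : Matrix.specialUnitaryGroup n ℂ) : Matrix n n ℂ) - ((g₁ b.src * (g₂ b.src)⁻¹ : Matrix.specialUnitaryGroup n ℂ) : Matrix n n ℂ)‖ ≤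
      ‖((GaugeField.gaugeAct g₁ U b : Matrix.specialUnitaryGroup n ℂ) : Matrix n n ℂ) - 1‖ + ‖((GaugeField.gaugeAct g₂ U b : Matrix.specialUnitaryGroup n ℂ) : Matrix n n ℂ) - 1‖ := by
  set A : Matrix.specialUnitaryGroup n ℂ := GaugeField.gaugeAct g₁ U b with hA
  set B : Matrix.specialUnitaryGroup n ℂ := GaugeField.gaugeAct g₂ U b with hB
  set t : Matrix.specialUnitaryGroup n ℂ := g₁ b.src * (g₂ b.src)⁻¹ with ht
  rw [relGauge_tgt_eq g₁ g₂ U b, ← hA, ← hB, ← ht, Submonoid.coe_mul, Submonoid.coe_mul]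
  have hAinv : ((A⁻¹ : Matrix.specialUnitaryGroup n ℂ) : Matrix n n ℂ) = star (A : Matrix n n ℂ) := rfl
  rw [hAinv]
  have e : star (A : Matrix n n ℂ) * (t : Matrix n n ℂ) * (B : Matrix n n ℂ) - (t : Matrix n n ℂ) =
      (star (A : Matrix n n ℂ) - 1) * (t : Matrix n n ℂ) * (B : Matrix n n ℂ) + (t : Matrix n n ℂ) * ((B : Matrix n n ℂ) - 1) := by noncomm_ring
  rw [e]
  have hsA : ‖star (A : Matrix n n ℂ) - 1‖ = ‖(A : Matrix n n ℂ) - 1‖ := by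
    rw [← hAinv, ← PerturbedPlaquette.dist1_SU_eq, GaugeGroup.dist1_inv, PerturbedPlaquette.dist1_SU_eq]
  calc ‖(star (A : Matrix n n ℂ) - 1) * (t : Matrix n n ℂ) * (B : Matrix n n ℂ) + (t : Matrix n n ℂ) * ((B : Matrix n n ℂ) - 1)‖
      ≤ ‖(star (A : Matrix n n ℂ) - 1) * (t : Matrix n n ℂ) * (B : Matrix n n ℂ)‖ + ‖(t : Matrix n n ℂ) * ((B : Matrix n n ℂ) - 1)‖ := norm_add_le _ _
    _ = ‖star (A : Matrix n n ℂ) - 1‖ + ‖(B : Matrix n n ℂ) - 1‖ := by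
        rw [CStarRing.norm_mul_mem_unitary _ B.2.1, CStarRing.norm_mul_mem_unitary _ t.2.1, CStarRing.norm_mem_unitary_mul _ t.2.1]
    _ = _ := by rw [hsA]

/-! ## §2 Drift of the relative gauge along a walk -/

/-- **★★ THE DRIFT BOUND**: along the lattice walk spelled by `w` from `x`, if every traversed bond has `‖U^{g₁}_b − 1‖ ≤ η₁` and `‖U^{g₂}_b − 1‖ ≤ η₂`, then the relative gauge `t = g₁g₂⁻¹`
satisfies `‖t(end) − t(x)‖ ≤ (η₁ + η₂)·|w|`.  Two gauges flattening the same field on a connected overlap differ by a NEAR-CONSTANT rotation — no Stokes theorem, no comb geometry.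
[cite: Balaban1985Averaging, (8) p.18, (19) p.21] -/
theorem norm_relGauge_walkEnd_sub_le (g₁ g₂ : GaugeTransf P j (Matrix.specialUnitaryGroup n ℂ)) (U : GaugeField P j (Matrix.specialUnitaryGroup n ℂ)) {η₁ η₂ : ℝ} :
    ∀ (x : Site P j) (w : List (Letter P.d)),
      (∀ s ∈ walk x w, ‖((GaugeField.gaugeAct g₁ U s.bond : Matrix.specialUnitaryGroup n ℂ) : Matrix n n ℂ) - 1‖ ≤ η₁) →
      (∀ s ∈ walk x w, ‖((GaugeField.gaugeAct g₂ U s.bond : Matrix.specialUnitaryGroup n ℂ) : Matrix n n ℂ) - 1‖ ≤ η₂) →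
      ‖((g₁ (walkEnd x w) * (g₂ (walkEnd x w))⁻¹ : Matrix.specialUnitaryGroup n ℂ) : Matrix n n ℂ) - ((g₁ x * (g₂ x)⁻¹ : Matrix.specialUnitaryGroup n ℂ) : Matrix n n ℂ)‖ ≤
        (η₁ + η₂) * w.length
  | x, [], _, _ => by simp [walkEnd]
  | x, (μ, true) :: w, h₁, h₂ => by
    -- forward step over `b = ⟨x, μ⟩`, then the walk from `x + e_μ`
    have hb₁ := h₁ ⟨⟨x, μ⟩, true⟩ (by simp [walk])
    have hb₂ := h₂ ⟨⟨x, μ⟩, true⟩ (by simp [walk])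
    have ih := norm_relGauge_walkEnd_sub_le g₁ g₂ U (x.shift μ) w (fun s hs => h₁ s (by simp [walk, hs])) (fun s hs => h₂ s (by simp [walk, hs]))
    have hstep := norm_relGauge_tgt_sub_src_le g₁ g₂ U ⟨x, μ⟩
    have hη : 0 ≤ η₁ + η₂ := by
      have := (norm_nonneg _).trans hb₁; have := (norm_nonneg _).trans hb₂; linarith
    rw [walkEnd, List.length_cons]
    calc _ ≤ ‖((g₁ (walkEnd (x.shift μ) w) * (g₂ (walkEnd (x.shift μ) w))⁻¹ : Matrix.specialUnitaryGroup n ℂ) : Matrix n n ℂ) -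
              ((g₁ (x.shift μ) * (g₂ (x.shift μ))⁻¹ : Matrix.specialUnitaryGroup n ℂ) : Matrix n n ℂ)‖ +
            ‖((g₁ (x.shift μ) * (g₂ (x.shift μ))⁻¹ : Matrix.specialUnitaryGroup n ℂ) : Matrix n n ℂ) - ((g₁ x * (g₂ x)⁻¹ : Matrix.specialUnitaryGroup n ℂ) : Matrix n n ℂ)‖ :=
          norm_sub_le_norm_sub_add_norm_sub _ _ _
      _ ≤ (η₁ + η₂) * w.length + (η₁ + η₂) := add_le_add ih (hstep.trans (add_le_add hb₁ hb₂))
      _ = (η₁ + η₂) * ((w.length + 1 : ℕ) : ℝ) := by push_cast; ring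
  | x, (μ, false) :: w, h₁, h₂ => by
    -- backward step over `b = ⟨x − e_μ, μ⟩` (from `b₊ = x` to `b₋ = x − e_μ`), then the walk from `x − e_μ`
    have hb₁ := h₁ ⟨⟨x.unshift μ, μ⟩, false⟩ (by simp [walk])
    have hb₂ := h₂ ⟨⟨x.unshift μ, μ⟩, false⟩ (by simp [walk])
    have ih := norm_relGauge_walkEnd_sub_le g₁ g₂ U (x.unshift μ) w (fun s hs => h₁ s (by simp [walk, hs])) (fun s hs => h₂ s (by simp [walk, hs]))
    have hstep := norm_relGauge_tgt_sub_src_le g₁ g₂ U ⟨x.unshift μ, μ⟩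
    have hxt : PBond.tgt (⟨x.unshift μ, μ⟩ : PBond P j) = x := B10StarCount.shift_unshift x μ
    rw [hxt] at hstep
    rw [walkEnd, List.length_cons]
    calc _ ≤ ‖((g₁ (walkEnd (x.unshift μ) w) * (g₂ (walkEnd (x.unshift μ) w))⁻¹ : Matrix.specialUnitaryGroup n ℂ) : Matrix n n ℂ) -
              ((g₁ (x.unshift μ) * (g₂ (x.unshift μ))⁻¹ : Matrix.specialUnitaryGroup n ℂ) : Matrix n n ℂ)‖ +
            ‖((g₁ (x.unshift μ) * (g₂ (x.unshift μ))⁻¹ : Matrix.specialUnitaryGroup n ℂ) : Matrix n n ℂ) - ((g₁ x * (g₂ x)⁻¹ : Matrix.specialUnitaryGroup n ℂ) : Matrix n n ℂ)‖ :=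
          norm_sub_le_norm_sub_add_norm_sub _ _ _
      _ ≤ (η₁ + η₂) * w.length + (η₁ + η₂) := by
          refine add_le_add ih ?_
          rw [norm_sub_rev]
          exact hstep.trans (add_le_add hb₁ hb₂)
      _ = (η₁ + η₂) * ((w.length + 1 : ℕ) : ℝ) := by push_cast; ring

/-! ## §3 Consequences for rotated data -/

omit [Nonempty n] in
/-- `‖t X t* − t₀ X t₀*‖ ≤ 2‖t − t₀‖·‖X‖` for `t, t₀ ∈ SU(n)`. [folklore] -/
theorem norm_conj_sub_conj_le (t t₀ : Matrix.specialUnitaryGroup n ℂ) (X : Matrix n n ℂ) :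
    ‖(t : Matrix n n ℂ) * X * star (t : Matrix n n ℂ) - (t₀ : Matrix n n ℂ) * X * star (t₀ : Matrix n n ℂ)‖ ≤ 2 * ‖(t : Matrix n n ℂ) - (t₀ : Matrix n n ℂ)‖ * ‖X‖ := by
  have e : (t : Matrix n n ℂ) * X * star (t : Matrix n n ℂ) - (t₀ : Matrix n n ℂ) * X * star (t₀ : Matrix n n ℂ) =
      ((t : Matrix n n ℂ) - (t₀ : Matrix n n ℂ)) * X * star (t : Matrix n n ℂ) + (t₀ : Matrix n n ℂ) * X * (star (t : Matrix n n ℂ) - star (t₀ : Matrix n n ℂ)) := by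
    noncomm_ring
  rw [e]
  have hs : ‖star (t : Matrix n n ℂ) - star (t₀ : Matrix n n ℂ)‖ = ‖(t : Matrix n n ℂ) - (t₀ : Matrix n n ℂ)‖ := by
    rw [← star_sub, norm_star]
  calc _ ≤ ‖((t : Matrix n n ℂ) - (t₀ : Matrix n n ℂ)) * X * star (t : Matrix n n ℂ)‖ + ‖(t₀ : Matrix n n ℂ) * X * (star (t : Matrix n n ℂ) - star (t₀ : Matrix n n ℂ))‖ := norm_add_le _ _
    _ ≤ ‖(t : Matrix n n ℂ) - (t₀ : Matrix n n ℂ)‖ * ‖X‖ + ‖X‖ * ‖star (t : Matrix n n ℂ) - star (t₀ : Matrix n n ℂ)‖ := by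
        gcongr
        · rw [CStarRing.norm_mul_mem_unitary _ (Unitary.star_mem t.2.1)]; exact norm_mul_le _ _
        · rw [mul_assoc, CStarRing.norm_mem_unitary_mul _ t₀.2.1]; exact norm_mul_le _ _
    _ = 2 * ‖(t : Matrix n n ℂ) - (t₀ : Matrix n n ℂ)‖ * ‖X‖ := by rw [hs]; ring

/-- **★ ROTATING BY THE RELATIVE GAUGE AT THE END OF A WALK VS AT ITS START** costs `2(η₁+η₂)|w|·‖X‖`: the frame-mismatch error of data or fields read in two stencil gauges of the same
flat-ish start, as it enters `‖T∘R − 1‖` of the Newton shell. [cite: Balaban1985Averaging, (11)–(13) p.19, (19) p.21] -/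
theorem norm_conj_relGauge_walkEnd_sub_le (g₁ g₂ : GaugeTransf P j (Matrix.specialUnitaryGroup n ℂ)) (U : GaugeField P j (Matrix.specialUnitaryGroup n ℂ)) {η₁ η₂ : ℝ}
    (x : Site P j) (w : List (Letter P.d))
    (h₁ : ∀ s ∈ walk x w, ‖((GaugeField.gaugeAct g₁ U s.bond : Matrix.specialUnitaryGroup n ℂ) : Matrix n n ℂ) - 1‖ ≤ η₁)
    (h₂ : ∀ s ∈ walk x w, ‖((GaugeField.gaugeAct g₂ U s.bond : Matrix.specialUnitaryGroup n ℂ) : Matrix n n ℂ) - 1‖ ≤ η₂) (X : Matrix n n ℂ) :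
    ‖((g₁ (walkEnd x w) * (g₂ (walkEnd x w))⁻¹ : Matrix.specialUnitaryGroup n ℂ) : Matrix n n ℂ) * X *
          star ((g₁ (walkEnd x w) * (g₂ (walkEnd x w))⁻¹ : Matrix.specialUnitaryGroup n ℂ) : Matrix n n ℂ) -
        ((g₁ x * (g₂ x)⁻¹ : Matrix.specialUnitaryGroup n ℂ) : Matrix n n ℂ) * X * star ((g₁ x * (g₂ x)⁻¹ : Matrix.specialUnitaryGroup n ℂ) : Matrix n n ℂ)‖ ≤
      2 * ((η₁ + η₂) * w.length) * ‖X‖ :=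
  (norm_conj_sub_conj_le _ _ X).trans (by
    have h := norm_relGauge_walkEnd_sub_le g₁ g₂ U x w h₁ h₂
    have hX := norm_nonneg X
    nlinarith)

end Summit.QuantumFields.YangMills.Theorems.RelativeGauge

end
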